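/-
Origin: expansion seat `planner-pub-hodgecm-pv01-g2-0`, handover #5 2026-08-18T05:11:57Z (`HOME/pub-hodgecm-pv01-g2/lean/Pv01g2/RealApproximationWeil.lean`, md5 013e71d5, 128 lines);
landed by the gen-6 packager in gate run 22 as `HodgeCM/PerL34/RealApproximationWeil.lean` (import ^import Pv[0-9]+g[0-9]+\.→import HodgeCM.PerL34. ×1; stripped 2 #print/#check/#eval lines).
-/
/-
Copyright: publication cell pub-hodgecm (DAG-NODE PROVER #01, generation 2, planner-pub-hodgecm-pv01-g2-0).
Lean 4 / Mathlib.

# `RealApproximationWeil` — the carver's top-level assembly `perL_of_weilDictLeaves` with the PRINT leaf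
`Dense Δ` of its S1 residual `hW` DISCHARGED IN KERNEL

pv03's `CharSpansWeil.WeilStepsInput T` (the per-context residual of node N33 = PerL v5 Prop 4.3 after seams S1/S2
were wired by name; consumed by the carver's `AssemblyWeil.perL_of_weilDictLeaves`) still carries the PRINT conjunct
`Dense (M.toBallSpanModel.toBallFormsModel.Δ : Set U21)` — real approximation for `G_U` at `ι₁`, PerL v5
ll. 672–677, cited there to [San, Cor. 3.5(iii)] / [PR, Thm. 7.7] (neither held by the cell).

`WeilStepsInputΔ T` is the same Prop with that conjunct replaced by the DEFINITIONAL identification of the model's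
arithmetic subgroup `M.Γ ⊂ U(2,1) × G_c × G_f` with the image of `G_U(L₀) = U(V.Hm)(L)` under
`(g ↦ frame conjugate of ι₁(g)) × ψ` for SOME frame `Tfr` of `ι₁(V.Hm)` and SOME homomorphism `ψ` to the other
factors (PerL l. 657: "Δ = the image of `G_U(L₀)` in `U(2,1)`"; what `ψ` is — the diagonal map to
`∏_{b ≠ ι₁} U(3) × G_U(𝔸_f)` — is irrelevant for density).  Then

* `weilStepsInput_of_delta : WeilStepsInputΔ T → WeilStepsInput T` — the density conjunct is the KERNEL theorem
  `RealApproximation.dense_map_fst_range` (Cayley-transform proof, `HodgeCM.PerL34.RealApproximation{,Ball}`);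
* `perL_of_weilDictLeavesΔ` — the carver's `perL_of_weilDictLeaves` verbatim with `hW : WeilStepsInputΔ T`;
* `N33_wedge_of_weilΔ` — likewise for `N33_wedge_of_weil`.

So in the top-level assembly the S1 residual no longer contains any real-approximation print leaf: what is left in
`hW` is the Weil package (dictionary + PRINT "ω is a representation"), `HolFrame`, the image-of-`G_U(L₀)`
identification (DEFINITIONAL), and the three dictionary Props D1/D2/PRINT-DEFINITIONAL `Dict_cupWedge`.

NOTHING is cited or posited here; no placeholders; standard axioms only (see the `#print axioms` lines at the end).
-/
import Summits.HodgeConjecture.HodgeCM.PerL34.AssemblyWeil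
import Summits.HodgeConjecture.HodgeCM.PerL34.RealApproximationBall

set_option autoImplicit false

noncomputable section

open scoped Matrix

namespace HodgeCM
namespace PerL34

/-! ## The S1 residual with `Dense Δ` replaced by "Γ is the image of `G_U(L₀)`" -/

namespace CharSpansWeil

open HodgeCM.PerL34.BallModel HodgeCM.PerL34.BallSpans HodgeCM.PerL34.BallFrame HodgeCM.PerL34.CharSpans
  HodgeCM.PerL34.RealApproximation
open Literature.AlgebraicGeometry.ShimuraVarieties (unitaryGroup conjRingHomK)

variable {U : Universe} (T : U.ThetaModel)

/-- **`WeilStepsInput` with the PRINT conjunct `Dense Δ` replaced by the DEFINITIONAL one**: for some frame `Tfr`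
of `ι₁(V.Hm)` (`Tfrᴴ · ι₁(H) · Tfr = J`) and some homomorphism `ψ : U(V.Hm)(L) → G_c × G_f`, the model's `Γ` is the
range of `toU21 × ψ`, i.e. the image of `G_U(L₀)` in `U(2,1) × G_c × G_f`. -/
def WeilStepsInputΔ : Prop :=
  ∀ {L : CMField} {ι₁ : L →+* ℂ} (V : HermSpace3 L ι₁) (c : SeesawCtx L), T.GoodCtx ι₁ c →
    ∃ M : CharLineSpans T V c, Nonempty (WeilPackage M) ∧ HolFrame M.toBallSpanModel.toLineSpans ∧
      (∃ (Tfr : GL3) (hT : (Tfr : Matrix (Fin 3) (Fin 3) ℂ)ᴴ * V.Hm.map ι₁ * Tfr = J)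
          (ψ : unitaryGroup (conjRingHomK L) V.Hm →* M.Gc × M.Gf),
          M.Γ = ((toU21 V Tfr hT).prod ψ).range) ∧
      M.toBallSpanModel.toBallFormsModel.toFormsModelT.Dict_thetaClass₀ T c ∧
      M.toBallSpanModel.toBallFormsModel.toFormsModelT.Dict_thetaClass₁ T c ∧
      M.toBallSpanModel.toBallFormsModel.toFormsModelT.toFormsModel.Dict_cupWedge

variable {T} in
/-- The density conjunct of `M.Inputs` from the image-of-`G_U(L₀)` identification (KERNEL real approximation). -/
theorem dense_Δ_of_range {L : CMField} {ι₁ : L →+* ℂ} {V : HermSpace3 L ι₁} {c : SeesawCtx L}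
    (M : CharLineSpans T V c) (Tfr : GL3) (hT : (Tfr : Matrix (Fin 3) (Fin 3) ℂ)ᴴ * V.Hm.map ι₁ * Tfr = J)
    (ψ : unitaryGroup (conjRingHomK L) V.Hm →* M.Gc × M.Gf)
    (hΓ : M.Γ = ((toU21 V Tfr hT).prod ψ).range) :
    Dense (M.toBallSpanModel.toBallFormsModel.Δ : Set U21) := by
  change Dense ((M.Γ.map (MonoidHom.fst U21 (M.Gc × M.Gf)) : Subgroup U21) : Set U21)
  rw [hΓ]
  exact dense_map_fst_range V Tfr hT ψ

/-- **`WeilStepsInputΔ T → WeilStepsInput T`**: the PRINT leaf `Dense Δ` of the S1 residual is discharged. -/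
theorem weilStepsInput_of_delta (h : WeilStepsInputΔ T) : WeilStepsInput T := by
  intro L ι₁ V c hc
  obtain ⟨M, hP, hH, ⟨Tfr, hT, ψ, hΓ⟩, h₀, h₁, hcup⟩ := h V c hc
  exact ⟨M, hP, hH, dense_Δ_of_range M Tfr hT ψ hΓ, h₀, h₁, hcup⟩

/-- Node N33 (`Open_thetaWedge`) with S1/S2 wired and NO real-approximation print leaf. -/
theorem open_thetaWedge_of_weilΔ (hE : WedgeToClasses.N33eClosed) (h31 : ClusterOutputs T)
    (h : WeilStepsInputΔ T) : T.Open_thetaWedge :=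
  open_thetaWedge_of_weil T hE h31 (weilStepsInput_of_delta T h)

end CharSpansWeil

/-! ## The carver's top-level assembly over `WeilStepsInputΔ` -/

namespace AssemblyWeil

open HodgeCM.Prior.Perl34File HodgeCM.Prior.Perl34File.Perl34 HodgeCM.PerL34.ArchC

variable {U : Universe}

/-- **PerL from the print leaves, the dictionary records and the Weil typing, real approximation IN KERNEL**:
the carver's `perL_of_weilDictLeaves` with `hW : WeilStepsInputΔ T` (no `Dense Δ` print leaf). -/
theorem perL_of_weilDictLeavesΔ (M : U.ModelAxioms) (T : U.ThetaModel)
    (h07 : N07_hodgeRiemann20 U) (h09a : N09a_embCover T) (h09b : N09b_innerEmb T)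
    (hM38 : U.Fact_cmInflation) (hAlb : T.Fact_thetaAlbanese) (h12b : N12b_signRecipe T)
    (hbr : ∀ {L : CMField} {ι₁ : L →+* ℂ} (V : HermSpace3 L ι₁) (c : SeesawCtx L), T.GoodCtx ι₁ c →
      Nonempty (SeesawDictionary.SeesawBridge T V c (T.t12 V c) 0 1))
    (hQ : ∀ {L : CMField} {ι₁ : L →+* ℂ} (V : HermSpace3 L ι₁) (c : SeesawCtx L), T.GoodCtx ι₁ c →
      Nonempty (QautDictionary.QautBridge T V c (T.t34 V c) 2 3))
    (Pc : ∀ {L : CMField} {ι₁ : L →+* ℂ} (V : HermSpace3 L ι₁) (c : SeesawCtx L),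
      C4a.PointedCore (T.core V c))
    (A12 : ∀ {L : CMField} {ι₁ : L →+* ℂ} (V : HermSpace3 L ι₁) (c : SeesawCtx L),
      T.GoodCtx ι₁ c → Nonempty (ArchCDatum (T.core V c) (T.t12 V c) (Pc V c)))
    (A34 : ∀ {L : CMField} {ι₁ : L →+* ℂ} (V : HermSpace3 L ι₁) (c : SeesawCtx L),
      T.GoodCtx ι₁ c → Nonempty (ArchCDatum (T.core V c) (T.t34 V c) (Pc V c)))
    (h31 : ClusterOutputs T) (hW : CharSpansWeil.WeilStepsInputΔ T) : U.PerL :=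
  perL_of_weilDictLeaves M T h07 h09a h09b hM38 hAlb h12b hbr hQ Pc A12 A34 h31
    (CharSpansWeil.weilStepsInput_of_delta T hW)

/-- `N33_wedge T` from `h31` and `hW : WeilStepsInputΔ T` alone (`N33eClosed` and real approximation both KERNEL). -/
theorem N33_wedge_of_weilΔ (T : U.ThetaModel) (h31 : ClusterOutputs T) (hW : CharSpansWeil.WeilStepsInputΔ T) :
    N33_wedge T :=
  N33_wedge_of_weil T h31 (CharSpansWeil.weilStepsInput_of_delta T hW)

end AssemblyWeil
end PerL34
end HodgeCM

end

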